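import Summits.MatrixMultiplication.MatrixMultiplication.Theorems.LevelGradedCohnUmansLevelOneGL2DesignsTraceLiftNorm

/-!
# The order `ℤ[2cos(2π/11)]`, part 3: the trace-zero slice and the tangency set (Pohoata's Prop. 5.1 at `d = 5`)
(wall-breaker axis `parabola lifts over finite fields`, stub `stub_tangencySets` of the crux `LevelOneGL2Designs`,
stmt-MatrixMultiplication-14080, file 3/4)

With the order `R = ℤ[α]`, `α = 2cos(2π/11)` of `…TraceLiftOrder` / `…TraceLiftNorm`:

* `vec_sq`, `abs_sqv_le` — the squaring map on coordinates (explicit quadratic lists) and its box bound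
  `|(d²)ₖ| ≤ 99 M²` for `|dᵢ| ≤ M`;
* `trace_sq_eq_zero_imp` — the TRACE FORM IS POSITIVE DEFINITE: with `Tr(Σ cᵢαⁱ) = 5c₀ − c₁ + 9c₂ − 4c₃ + 25c₄`
  (the power sums of `f`), `Tr(d²) = 0 ⇒ d = 0`, by the explicit sum-of-squares
  `60·Tr(d²) = 12(5d₀−d₁+9d₂−4d₃+25d₄)² + 33(4d₁−d₂+11d₃−5d₄)² + 55(3d₂−d₃+11d₄)² + 110(2d₃−d₄)² + 330d₄²`
  (total reality of `ℚ(ζ₁₁)⁺`, the heart of Pohoata's Observation 3.1, in integers);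
* `tangencySet_of_lift` — the abstract parabola lift: for ANY commutative ring `S`, ring map `g : S → ZMod p` and finite
  `A, Y ⊆ S` such that `g` detects `a' − a + (y' − y)² = 0` on `A, Y` ("no wrap-around") and `A` has no two elements
  differing by a square of a difference of `Y` ("square-difference-free"), the points `(g a + (g y)², g y)` with the
  lines of normal `(1, −2 g y)` form an affine tangency set of `AG(2,p)` of size `|A|·|Y|` (Pohoata, Cor. 2.2 / §5);
* `exists_tangencySet_traceLift` — **the degree-5 trace-zero lift**: for a ring map `g : ℤ[α] → ZMod p` and
  `L, M` with `7023·(39L + 99M²)⁵ < p`, a tangency set of size `L⁴·M⁵` — `Y` = the coordinate box `[0,M)⁵`,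
  `A` = the trace-zero vectors `(b₀ − 9b₁ + 4b₂ − 25b₃, 5b₀, 5b₁, 5b₂, 5b₃)`, `b ∈ [0,L)⁴`.  With `L = M²` and
  `p ≍ M¹⁰` this is `M¹³ ≍ p^{13/10}` points (`…TraceLiftThirteenTenths`).

Elementary given parts 1–2; no definitions (file-local notation only).
[cite: Pohoata2026SharpExponentMinimalDistance, Prop. 3.2, Prop. 5.1]
-/

-- the summit/problem path `MatrixMultiplication.MatrixMultiplication` is fixed by the tree layout (D-0017)
set_option linter.dupNamespace false

noncomputable section

open Polynomial Finset Matrix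

namespace Summit.MatrixMultiplication.MatrixMultiplication.Theorems.LevelOneGL2Designs.TraceLift

/-- The minimal polynomial `f = X⁵ + X⁴ − 4X³ − 3X² + 3X + 1` of `2cos(2π/11)` (file-local notation). -/
local notation "f11" => (X ^ 5 + X ^ 4 - 4 * X ^ 3 - 3 * X ^ 2 + 3 * X + 1 : ℤ[X])
/-- The order `ℤ[2cos(2π/11)] = ℤ[X]/(f)` (file-local notation). -/
local notation "R11" => AdjoinRoot f11
/-- Its generator `α = X mod f` (file-local notation). -/
local notation "α" => AdjoinRoot.root f11
/-- The structure map `ℤ → ℤ[α]` (file-local notation). -/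
local notation "ofZ" => AdjoinRoot.of f11
/-- The element with integer coordinates `c` in the power basis `1, α, …, α⁴` (file-local notation). -/
local notation "vec" c:max => (∑ i : Fin 5, ofZ (c i) * α ^ (i : ℕ))

/-- Evaluation of a coefficient–exponent list at the coordinate vector `c` (file-local notation): the explicit forms
below are stored as lists `(coefficient, e₀, e₁, e₂, e₃, e₄)` to keep elaboration cheap. -/
local notation "evalQ" L:max c:max =>
  (List.sum (List.map (fun t : ℤ × ℕ × ℕ × ℕ × ℕ × ℕ =>
    Prod.fst t * c 0 ^ Prod.fst (Prod.snd t) * c 1 ^ Prod.fst (Prod.snd (Prod.snd t)) *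
      c 2 ^ Prod.fst (Prod.snd (Prod.snd (Prod.snd t))) * c 3 ^ Prod.fst (Prod.snd (Prod.snd (Prod.snd (Prod.snd t)))) *
      c 4 ^ Prod.snd (Prod.snd (Prod.snd (Prod.snd (Prod.snd t))))) L))

/-- The squaring map on coordinates, coordinate `0`, as a quadratic coefficient list (file-local notation). -/
local notation "SQ0" => ([(6, 0, 0, 0, 0, 2), ((-10), 0, 0, 0, 1, 1), (1, 0, 0, 0, 2, 0), (2, 0, 0, 1, 0, 1), ((-2), 0, 0, 1, 1, 0), ((-2), 0, 1, 0, 0, 1),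
    (1, 2, 0, 0, 0, 0)] : List (ℤ × ℕ × ℕ × ℕ × ℕ × ℕ))
/-- Squaring, coordinate `1`. -/
local notation "SQ1" => ([(13, 0, 0, 0, 0, 2), ((-28), 0, 0, 0, 1, 1), (2, 0, 0, 0, 2, 0), (4, 0, 0, 1, 0, 1), ((-6), 0, 0, 1, 1, 0), ((-6), 0, 1, 0, 0, 1),
    (2, 1, 1, 0, 0, 0)] : List (ℤ × ℕ × ℕ × ℕ × ℕ × ℕ))
/-- Squaring, coordinate `2`. -/
local notation "SQ2" => ([((-32), 0, 0, 0, 0, 2), (34, 0, 0, 0, 1, 1), ((-6), 0, 0, 0, 2, 0), ((-12), 0, 0, 1, 0, 1), (6, 0, 0, 1, 1, 0), (6, 0, 1, 0, 0, 1),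
    (1, 0, 2, 0, 0, 0), (2, 1, 0, 1, 0, 0)] : List (ℤ × ℕ × ℕ × ℕ × ℕ × ℕ))
/-- Squaring, coordinate `3`. -/
local notation "SQ3" => ([((-7), 0, 0, 0, 0, 2), (28, 0, 0, 0, 1, 1), ((-1), 0, 0, 0, 2, 0), ((-2), 0, 0, 1, 0, 1), (8, 0, 0, 1, 1, 0), (8, 0, 1, 0, 0, 1),
    (2, 0, 1, 1, 0, 0), (2, 1, 0, 0, 1, 0)] : List (ℤ × ℕ × ℕ × ℕ × ℕ × ℕ))
/-- Squaring, coordinate `4`. -/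
local notation "SQ4" => ([(20, 0, 0, 0, 0, 2), ((-12), 0, 0, 0, 1, 1), (5, 0, 0, 0, 2, 0), (10, 0, 0, 1, 0, 1), ((-2), 0, 0, 1, 1, 0), (1, 0, 0, 2, 0, 0),
    ((-2), 0, 1, 0, 0, 1), (2, 0, 1, 0, 1, 0), (2, 1, 0, 0, 0, 1)] : List (ℤ × ℕ × ℕ × ℕ × ℕ × ℕ))
/-- The coordinate vector of the square of `Σ dᵢ αⁱ` (file-local notation). -/
local notation "sqv" d:max => (![evalQ SQ0 d, evalQ SQ1 d, evalQ SQ2 d, evalQ SQ3 d, evalQ SQ4 d] : Fin 5 → ℤ)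
/-- The trace functional on coordinates, `Tr(Σ cᵢ αⁱ) = Σ cᵢ Tr(αⁱ)`, `Tr(αⁱ) = 5, −1, 9, −4, 25` (file-local
notation). -/
local notation "TrV" c:max => (5 * c 0 - c 1 + 9 * c 2 - 4 * c 3 + 25 * c 4 : ℤ)
/-- The trace-zero parametrisation `b ↦ (b₀ − 9b₁ + 4b₂ − 25b₃, 5b₀, 5b₁, 5b₂, 5b₃)` (file-local notation). -/
local notation "amap" b:max => (![b 0 - 9 * b 1 + 4 * b 2 - 25 * b 3, 5 * b 0, 5 * b 1, 5 * b 2, 5 * b 3] : Fin 5 → ℤ)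

/-- `vec` is additive. [elementary] -/
theorem vec_add (c d : Fin 5 → ℤ) : vec c + vec d = vec (c + d) := by
  rw [← Finset.sum_add_distrib]
  refine Finset.sum_congr rfl fun i _ => ?_
  rw [Pi.add_apply, map_add, add_mul]

/-- `vec` respects subtraction. [elementary] -/
theorem vec_sub (c d : Fin 5 → ℤ) : vec c - vec d = vec (c - d) := by
  rw [← Finset.sum_sub_distrib]
  refine Finset.sum_congr rfl fun i _ => ?_
  rw [Pi.sub_apply, map_sub, sub_mul]

/-- `vec 0 = 0`. [elementary] -/
theorem vec_zero : vec (0 : Fin 5 → ℤ) = 0 := by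
  simp

/-- **Squaring on coordinates**: `(Σ dᵢ αⁱ)² = Σ (d²)ₖ αᵏ` with the explicit quadratic forms `(d²)ₖ = evalQ SQk d`
(the diagonal of the multiplication table). [elementary] -/
theorem vec_sq (d : Fin 5 → ℤ) : vec d * vec d = vec (sqv d) := by
  rw [vec_mul_vec]
  congr 1
  funext i
  fin_cases i <;>
    simp only [Fin.zero_eta, Fin.isValue, Fin.mk_one, Fin.reduceFinMk, Matrix.cons_val_zero, Matrix.cons_val_one,
      Matrix.head_cons, Matrix.cons_val_two, Matrix.tail_cons, Matrix.cons_val_three, Matrix.cons_val_four] <;>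
    simp only [List.map, List.sum_cons, List.sum_nil, pow_zero, pow_one, mul_one] <;>
    ring

/-- Box bound for the squaring map: `|(d²)ₖ| ≤ 99·M²` when all `|dᵢ| ≤ M` (`99` = the largest coefficient sum
of the five quadratic forms). [elementary] -/
theorem abs_sqv_le (d : Fin 5 → ℤ) (M : ℤ) (hd : ∀ i, |d i| ≤ M) (k : Fin 5) : |(sqv d) k| ≤ 99 * M ^ 2 := by
  have hM : 0 ≤ M ^ 2 := sq_nonneg M
  have h0 := abs_evalQ_le d M hd 2 SQ0 (by decide +kernel)
  have h1 := abs_evalQ_le d M hd 2 SQ1 (by decide +kernel)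
  have h2 := abs_evalQ_le d M hd 2 SQ2 (by decide +kernel)
  have h3 := abs_evalQ_le d M hd 2 SQ3 (by decide +kernel)
  have h4 := abs_evalQ_le d M hd 2 SQ4 (by decide +kernel)
  have s0 : ((SQ0).map fun t => |Prod.fst t|).sum = 24 := by decide +kernel
  have s1 : ((SQ1).map fun t => |Prod.fst t|).sum = 61 := by decide +kernel
  have s2 : ((SQ2).map fun t => |Prod.fst t|).sum = 99 := by decide +kernel
  have s3 : ((SQ3).map fun t => |Prod.fst t|).sum = 58 := by decide +kernel
  have s4 : ((SQ4).map fun t => |Prod.fst t|).sum = 56 := by decide +kernel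
  rw [s0] at h0; rw [s1] at h1; rw [s2] at h2; rw [s3] at h3; rw [s4] at h4
  fin_cases k <;>
    simp only [Fin.zero_eta, Fin.isValue, Fin.mk_one, Fin.reduceFinMk, Matrix.cons_val_zero, Matrix.cons_val_one,
      Matrix.head_cons, Matrix.cons_val_two, Matrix.tail_cons, Matrix.cons_val_three, Matrix.cons_val_four] <;>
    linarith

/-- **The trace form of `ℤ[2cos(2π/11)]` is positive definite** (total reality, in integers): if
`Tr((Σ dᵢ αⁱ)²) = 0` then `d = 0`.  Proof: `60·Tr(d²)` is the explicit sum of five squares with positive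
coefficients displayed in the module docstring (an `LDLᵀ` factorisation of the Gram matrix of power sums
`(5, −1, 9, −4, 25, −16, 78, −64, 257)`). [cite: Pohoata2026SharpExponentMinimalDistance, Observation 3.1] -/
theorem trace_sq_eq_zero_imp (d : Fin 5 → ℤ) (h : TrV (sqv d) = 0) : d = 0 := by
  have hsos : 60 * TrV (sqv d) = 12 * (5 * d 0 - d 1 + 9 * d 2 - 4 * d 3 + 25 * d 4) ^ 2 +
      33 * (4 * d 1 - d 2 + 11 * d 3 - 5 * d 4) ^ 2 + 55 * (3 * d 2 - d 3 + 11 * d 4) ^ 2 +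
      110 * (2 * d 3 - d 4) ^ 2 + 330 * d 4 ^ 2 := by
    simp only [Matrix.cons_val_zero, Matrix.cons_val_one, Matrix.head_cons, Matrix.cons_val_two, Matrix.tail_cons,
      Matrix.cons_val_three, Matrix.cons_val_four, List.map, List.sum_cons, List.sum_nil, pow_zero, pow_one,
      mul_one]
    ring
  rw [h, mul_zero] at hsos
  have h4 : d 4 = 0 := by
    nlinarith [sq_nonneg (5 * d 0 - d 1 + 9 * d 2 - 4 * d 3 + 25 * d 4),
        sq_nonneg (4 * d 1 - d 2 + 11 * d 3 - 5 * d 4), sq_nonneg (3 * d 2 - d 3 + 11 * d 4),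
        sq_nonneg (2 * d 3 - d 4), sq_nonneg (d 4)]
  have h3 : d 3 = 0 := by
    nlinarith [sq_nonneg (5 * d 0 - d 1 + 9 * d 2 - 4 * d 3 + 25 * d 4),
        sq_nonneg (4 * d 1 - d 2 + 11 * d 3 - 5 * d 4), sq_nonneg (3 * d 2 - d 3 + 11 * d 4),
        sq_nonneg (2 * d 3 - d 4), sq_nonneg (d 4)]
  have h2 : d 2 = 0 := by
    nlinarith [sq_nonneg (5 * d 0 - d 1 + 9 * d 2 - 4 * d 3 + 25 * d 4),
        sq_nonneg (4 * d 1 - d 2 + 11 * d 3 - 5 * d 4), sq_nonneg (3 * d 2 - d 3 + 11 * d 4),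
        sq_nonneg (2 * d 3 - d 4), sq_nonneg (d 4)]
  have h1 : d 1 = 0 := by
    nlinarith [sq_nonneg (5 * d 0 - d 1 + 9 * d 2 - 4 * d 3 + 25 * d 4),
        sq_nonneg (4 * d 1 - d 2 + 11 * d 3 - 5 * d 4), sq_nonneg (3 * d 2 - d 3 + 11 * d 4),
        sq_nonneg (2 * d 3 - d 4), sq_nonneg (d 4)]
  have h0 : d 0 = 0 := by
    nlinarith [sq_nonneg (5 * d 0 - d 1 + 9 * d 2 - 4 * d 3 + 25 * d 4),
        sq_nonneg (4 * d 1 - d 2 + 11 * d 3 - 5 * d 4), sq_nonneg (3 * d 2 - d 3 + 11 * d 4),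
        sq_nonneg (2 * d 3 - d 4), sq_nonneg (d 4)]
  funext i
  fin_cases i <;> simp [h0, h1, h2, h3, h4]

/-- The trace-zero parametrisation lands in the kernel of the trace functional. [elementary] -/
theorem trV_amap (b : Fin 4 → ℤ) : TrV (amap b) = 0 := by
  simp only [Matrix.cons_val_zero, Matrix.cons_val_one, Matrix.head_cons, Matrix.cons_val_two, Matrix.tail_cons,
    Matrix.cons_val_three, Matrix.cons_val_four]
  ring

/-- The trace-zero parametrisation is injective. [elementary] -/
theorem amap_injective : Function.Injective fun b : Fin 4 → ℤ => amap b := by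
  intro b b' h
  have h1 := congrFun h 1
  have h2 := congrFun h 2
  have h3 := congrFun h 3
  have h4 := congrFun h 4
  simp only [Matrix.cons_val_zero, Matrix.cons_val_one, Matrix.head_cons, Matrix.cons_val_two, Matrix.tail_cons,
    Matrix.cons_val_three, Matrix.cons_val_four] at h1 h2 h3 h4
  funext i
  fin_cases i <;> simp <;> omega

variable {p : ℕ} [Fact p.Prime]

/-- **The abstract parabola lift** (Pohoata, Cor. 2.2 and §5, over any coefficient ring).  Let `S` be a commutative
ring, `g : S → ZMod p` a ring map, `A, Y ⊆ S` finite.  Assume (i) *no wrap-around*: for `a, a' ∈ A`, `y, y' ∈ Y`,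
`g (a' − a + (y' − y)²) = 0` forces `a' − a + (y' − y)² = 0` in `S`; (ii) *square-difference-freeness*:
`a − a' = (y' − y)²` forces `y = y'`.  Then the points `v(a,y) = (g a + (g y)², g y)` are `|A|·|Y|` distinct points
of `AG(2,p)` and the line through `v(a,y)` with normal `u = (1, −2·g y)` meets them only in `v(a,y)`: along the
line `X − Y²` changes by minus a square, `(g a' + g y'²) − 2 g y g y' = g a + g y² − 2 g y²` says
`g(a' − a + (y' − y)²) = 0`. [cite: Pohoata2026SharpExponentMinimalDistance, Cor. 2.2, Prop. 5.1] -/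
theorem tangencySet_of_lift {S : Type*} [CommRing S] (g : S →+* ZMod p) (A Y : Finset S)
    (h1 : ∀ a ∈ A, ∀ a' ∈ A, ∀ y ∈ Y, ∀ y' ∈ Y, g (a' - a + (y' - y) ^ 2) = 0 → a' - a + (y' - y) ^ 2 = 0)
    (h2 : ∀ a ∈ A, ∀ a' ∈ A, ∀ y ∈ Y, ∀ y' ∈ Y, a - a' = (y' - y) ^ 2 → y = y') :
    ∃ V : Finset (Fin 2 → ZMod p), V.card = A.card * Y.card ∧
      ∀ v ∈ V, ∃ u : Fin 2 → ZMod p, u ≠ 0 ∧ ∀ w ∈ V, u ⬝ᵥ w = u ⬝ᵥ v → w = v := by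
  classical
  -- the key: `g(a' - a + (y' - y)²) = 0` only trivially
  have key : ∀ a ∈ A, ∀ a' ∈ A, ∀ y ∈ Y, ∀ y' ∈ Y, g (a' - a + (y' - y) ^ 2) = 0 → a = a' ∧ y = y' := by
    intro a ha a' ha' y hy y' hy' h
    have h3 := h1 a ha a' ha' y hy y' hy' h
    have h4 : a - a' = (y' - y) ^ 2 := by linear_combination -h3
    have hyy := h2 a ha a' ha' y hy y' hy' h4
    subst hyy
    refine ⟨?_, rfl⟩
    have : a - a' = 0 := by rw [h4]; ring
    linear_combination this
  let pt : S × S → (Fin 2 → ZMod p) := fun ay => ![g ay.1 + g ay.2 ^ 2, g ay.2]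
  have hinj : Set.InjOn pt ↑(A ×ˢ Y) := by
    rintro ⟨a, y⟩ hay ⟨a', y'⟩ hay' h
    simp only [coe_product, Set.mem_prod, mem_coe] at hay hay'
    have hy : g y = g y' := by simpa [pt] using congr_fun h 1
    have ha : g a + g y ^ 2 = g a' + g y' ^ 2 := by simpa [pt] using congr_fun h 0
    have h0 : g (a' - a + (y' - y) ^ 2) = 0 := by
      rw [map_add, map_sub, map_pow, map_sub]
      linear_combination -ha + (2 * g y) * hy
    obtain ⟨rfl, rfl⟩ := key a hay.1 a' hay'.1 y hay.2 y' hay'.2 h0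
    rfl
  refine ⟨(A ×ˢ Y).image pt, by rw [card_image_of_injOn hinj, card_product], ?_⟩
  simp only [mem_image, mem_product]
  rintro _ ⟨⟨a, y⟩, ⟨ha, hy⟩, rfl⟩
  refine ⟨![1, -2 * g y], fun h => by simpa using congr_fun h 0, ?_⟩
  rintro _ ⟨⟨a', y'⟩, ⟨ha', hy'⟩, rfl⟩ h
  simp only [pt, vec2_dotProduct, Matrix.cons_val_zero, Matrix.cons_val_one] at h
  have h0 : g (a' - a + (y' - y) ^ 2) = 0 := by
    rw [map_add, map_sub, map_pow, map_sub]
    linear_combination h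
  obtain ⟨rfl, rfl⟩ := key a ha a' ha' y hy y' hy' h0
  rfl

/-- **No wrap-around for the trace-zero lift**: for `b, b' ∈ [0,L)⁴`, `y, y' ∈ [0,M)⁵` and
`7023·(39L + 99M²)⁵ < p`, if `g` kills `e = a(b') − a(b) + (y' − y)²` then `e` vanishes in `ℤ[α]` (its
coordinates are bounded by `39L + 99M²`; `vec_eq_zero_of_small`). [elementary] -/
theorem traceLift_noWrap
    (g : AdjoinRoot (X ^ 5 + X ^ 4 - 4 * X ^ 3 - 3 * X ^ 2 + 3 * X + 1 : ℤ[X]) →+* ZMod p) (L M : ℕ)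
    (hp : 7023 * (39 * (L : ℤ) + 99 * (M : ℤ) ^ 2) ^ 5 < p) (b b' : Fin 4 → ℤ)
    (hb0 : ∀ i, 0 ≤ b i ∧ b i < L) (hb1 : ∀ i, 0 ≤ b' i ∧ b' i < L) (y y' : Fin 5 → ℤ)
    (hy0 : ∀ i, 0 ≤ y i ∧ y i < M) (hy1 : ∀ i, 0 ≤ y' i ∧ y' i < M)
    (e : R11) (he : e = vec (amap b') - vec (amap b) + (vec y' - vec y) ^ 2) (h : g e = 0) : e = 0 := by
  -- the element is `vec c` for an explicit small coordinate vector `c`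
  have he' : e = vec ((amap b') - (amap b) + sqv (y' - y)) := by
    rw [he, vec_sub, vec_sub, sq (vec (y' - y)), vec_sq, vec_add]
  rw [he'] at h ⊢
  have hd : ∀ i, |(y' - y) i| ≤ (M : ℤ) := fun i => by
    rw [Pi.sub_apply, abs_le]
    have := hy0 i; have := hy1 i
    constructor <;> omega
  have hbound : ∀ k, |((amap b') - (amap b) + sqv (y' - y)) k| ≤ 39 * (L : ℤ) + 99 * (M : ℤ) ^ 2 := by
    intro k
    rw [Pi.add_apply]
    refine le_trans (abs_add_le _ _) (add_le_add ?_ (abs_sqv_le (y' - y) M hd k))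
    rw [Pi.sub_apply]
    have h0 := hb0 0; have h1 := hb0 1; have h2 := hb0 2; have h3 := hb0 3
    have h0' := hb1 0; have h1' := hb1 1; have h2' := hb1 2; have h3' := hb1 3
    fin_cases k <;>
      simp only [Fin.zero_eta, Fin.isValue, Fin.mk_one, Fin.reduceFinMk, Matrix.cons_val_zero,
        Matrix.cons_val_one, Matrix.head_cons, Matrix.cons_val_two, Matrix.tail_cons, Matrix.cons_val_three,
        Matrix.cons_val_four] <;>
      (rw [abs_le]; constructor <;> omega)
  have hz := vec_eq_zero_of_small g _ _ hbound hp h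
  rw [hz, vec_zero]

/-- **Square-difference-freeness of the trace-zero slice**: if `a(b) − a(b') = (y' − y)²` in `ℤ[α]` then
`y = y'` — apply the trace functional (`Tr ∘ a = 0`) and the positivity of the trace form. [elementary] -/
theorem traceLift_sqDiffFree (b b' : Fin 4 → ℤ) (y y' : Fin 5 → ℤ)
    (h : vec (amap b) - vec (amap b') = (vec y' - vec y) ^ 2) : y = y' := by
  rw [vec_sub, vec_sub, sq (vec (y' - y)), vec_sq] at h
  have hcoord := vec_injective _ _ h
  have htr : TrV (sqv (y' - y)) = 0 := by
    rw [← hcoord]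
    have t1 := trV_amap b
    have t2 := trV_amap b'
    simp only [Pi.sub_apply, Matrix.cons_val_zero, Matrix.cons_val_one, Matrix.head_cons, Matrix.cons_val_two,
      Matrix.tail_cons, Matrix.cons_val_three, Matrix.cons_val_four] at t1 t2 ⊢
    linear_combination t1 - t2
  have hd := trace_sq_eq_zero_imp _ htr
  exact (sub_eq_zero.mp hd).symm

/-- **Pohoata's trace-zero lift at degree `5` (the maximal real subfield of `ℚ(ζ₁₁)`)**: let `g : ℤ[α] → ZMod p` be a
ring map (`α = 2cos(2π/11)`; such `g` exists iff `p ≡ ±1 (mod 11)` or `p = 11`) and `L, M` with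
`7023·(39L + 99M²)⁵ < p`.  Then `AG(2,p)` contains an affine tangency set — points each on a line meeting the set
only there — with exactly `L⁴·M⁵` points.  Construction: `Y` = elements with coordinates in `[0,M)⁵`, `A` = the
trace-zero elements `(b₀ − 9b₁ + 4b₂ − 25b₃)·1 + 5b₀α + 5b₁α² + 5b₂α³ + 5b₃α⁴`, `b ∈ [0,L)⁴`; no wrap-around by
`vec_eq_zero_of_small` (the relevant coordinates are `≤ 39L + 99M²`), square-difference-freeness by the positive
definiteness of the trace form (`trace_sq_eq_zero_imp`), then `tangencySet_of_lift`.
[cite: Pohoata2026SharpExponentMinimalDistance, Prop. 5.1 (for `K = ℚ(ζ₁₁)⁺`)] -/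
theorem exists_tangencySet_traceLift
    (g : AdjoinRoot (X ^ 5 + X ^ 4 - 4 * X ^ 3 - 3 * X ^ 2 + 3 * X + 1 : ℤ[X]) →+* ZMod p) (L M : ℕ)
    (hp : 7023 * (39 * (L : ℤ) + 99 * (M : ℤ) ^ 2) ^ 5 < p) :
    ∃ V : Finset (Fin 2 → ZMod p), V.card = L ^ 4 * M ^ 5 ∧
      ∀ v ∈ V, ∃ u : Fin 2 → ZMod p, u ≠ 0 ∧ ∀ w ∈ V, u ⬝ᵥ w = u ⬝ᵥ v → w = v := by
  classical
  -- coordinate boxes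
  set YB : Finset (Fin 5 → ℤ) := Fintype.piFinset fun _ : Fin 5 => Finset.Ico (0 : ℤ) M with hYB
  set BB : Finset (Fin 4 → ℤ) := Fintype.piFinset fun _ : Fin 4 => Finset.Ico (0 : ℤ) L with hBB
  set AB : Finset (Fin 5 → ℤ) := BB.image fun b => amap b with hAB
  have memYB : ∀ y ∈ YB, ∀ i, 0 ≤ y i ∧ y i < M := fun y hy i => by
    have := Fintype.mem_piFinset.mp hy i
    simpa using this
  have memBB : ∀ b ∈ BB, ∀ i, 0 ≤ b i ∧ b i < L := fun b hb i => by
    have := Fintype.mem_piFinset.mp hb i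
    simpa using this
  -- the lift data in `ℤ[α]`
  set Y : Finset R11 := YB.image fun y => vec y with hY
  set A : Finset R11 := AB.image fun a => vec a with hA
  -- (i) no wrap-around, (ii) square-difference-freeness: unpack memberships and use the two lemmas above
  have h1 : ∀ a ∈ A, ∀ a' ∈ A, ∀ y ∈ Y, ∀ y' ∈ Y,
      g (a' - a + (y' - y) ^ 2) = 0 → a' - a + (y' - y) ^ 2 = 0 := by
    simp only [hA, hY, hAB, mem_image]
    rintro _ ⟨_, ⟨b, hb, rfl⟩, rfl⟩ _ ⟨_, ⟨b', hb', rfl⟩, rfl⟩ _ ⟨y, hy, rfl⟩ _ ⟨y', hy', rfl⟩ h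
    exact traceLift_noWrap g L M hp b b' (memBB b hb) (memBB b' hb') y y' (memYB y hy) (memYB y' hy') _ rfl h
  have h2 : ∀ a ∈ A, ∀ a' ∈ A, ∀ y ∈ Y, ∀ y' ∈ Y, a - a' = (y' - y) ^ 2 → y = y' := by
    simp only [hA, hY, hAB, mem_image]
    rintro _ ⟨_, ⟨b, hb, rfl⟩, rfl⟩ _ ⟨_, ⟨b', hb', rfl⟩, rfl⟩ _ ⟨y, hy, rfl⟩ _ ⟨y', hy', rfl⟩ h
    rw [traceLift_sqDiffFree b b' y y' h]
  obtain ⟨V, hV, htan⟩ := tangencySet_of_lift g A Y h1 h2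
  refine ⟨V, ?_, htan⟩
  -- cardinalities
  have hvinj : Function.Injective fun c : Fin 5 → ℤ => vec c := fun c c' h => vec_injective c c' h
  rw [hV, hA, hY, card_image_of_injective _ hvinj, card_image_of_injective _ hvinj, hAB,
    card_image_of_injective _ amap_injective, hBB, hYB, Fintype.card_piFinset, Fintype.card_piFinset]
  simp

end Summit.MatrixMultiplication.MatrixMultiplication.Theorems.LevelOneGL2Designs.TraceLift
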